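import Summits.QuantumFields.YangMills.Theorems.BalabanLadderNTStrongCouplingLongTubeFamily
import Summits.QuantumFields.YangMills.Theorems.BalabanLadderNTStrongCouplingLongTubeRing
import Summits.QuantumFields.YangMills.Theorems.BalabanLadderNTStrongCouplingConvPowerEighteen
import Summits.QuantumFields.YangMills.Theorems.BalabanLadderNTStrongCouplingConvPowerOdd
import Summits.QuantumFields.YangMills.Theorems.BalabanLadderNTStrongCouplingClosedFamilies
import HarnessLib

/-!
# Crux `NT` (stmt-QuantumFields-19353), strong-coupling rungs: the HAAR CONSTANT of the temporal tube of ANY length —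
# `κ_n = ∫ ∏_{4n+2 faces} φ(U_f) dg_∞ = φ^{⋆(4n+2)}(1) = ‖φ^{⋆(2n+1)}‖² > 0`

Helper file of the fleet lead prover of crux `NT` (unit `ym-spine-19353-p1`, g27), part III of the length-generic tube
toolkit.  The tree computes the ten-face box (`S28BoxConvChain/Gluing`, nine explicit merges) and the eighteen-face tubes
(`…LongTubeIntegral`, four literal `ring_transfer`s); here ONE induction on the length, for every base site `z`, every
spatial square `a` and every inversion-invariant continuous class function `φ` with convolution powers `P k`:

* `plaquette_update_of_notMem`, `notMem_plaquetteEdges_of_time_lt`, `prod_openTube_update`, `continuous_prod_plaquette`,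
  `prod_tubeSides` — bookkeeping: the spectator (the open tube one level up) does not read the bottom ring's links;
* **`openTube_integral`** — `∫ P k (U_{(z;a)}) · ∏_{f ∈ openTube z n a} φ(U_f) = P (k + 4n + 1)(1)`: at each level the four
  sides are glued to the disc by `…LongTubeRing.ring_transfer` (`P k ↦ P (k+4)` on the translated square), the top cap by
  `cap_merge`; the twelve links of a ring are kept apart by coordinate evaluations (symbolic `z`, `a₁`, `a₂`);
* `longTube_integral_eq_conv` — `∫ ∏_{f ∈ longTube z n a} φ(U_f) = P (4n + 1)(1)` (`n ≥ 1`);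
* `longTube_kappa_eq_conv`, `longTubes_kappa` — for `φ = Re tr ρ − m₀` the three tubes have the common value `κ_n`;
  **`longTube_kappa_pos_latticeRep`** — `κ_n(G, r) = ‖φ^{⋆(2n+1)}‖² > 0` for every `r : LatticeRep G` over a compact group
  with an element `≠ 1` (`…ConvPowerOdd.conv_power_odd_at_one_pos`).

HONEST FRAMING: Haar-measure algebra on an arbitrary compact group; nothing about `β`, NT or the gap. [folklore]
-/

/-! ## Part III — the HAAR CONSTANT of the tube of any length: `∫ ∏_{4n+2 faces} φ = φ^{⋆(4n+2)}(1)` -/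

noncomputable section

namespace Summit.QuantumFields.YangMills.Cruxes.NT.StrongCouplingRung.LongTube

open MeasureTheory Finset
open Literature.Probability.LatticeModels (Site)
open Literature.MathematicalPhysics.QuantumLattice (ZdEdge ZdPlaquette plaquetteEdges LGConfig haarConv)
open Literature.MathematicalPhysics.QuantumFieldTheory (zdHaar haarProbability ZdGaugeConfig
  level_bounds_of_mem_plaquetteEdges)
open Summit.QuantumFields.YangMills.Theorems (S28DistanceTwo.add_single_ne)

variable {G : Type} [Group G] [TopologicalSpace G] [IsTopologicalGroup G]
  [CompactSpace G] [MeasurableSpace G] [BorelSpace G] [SecondCountableTopology G]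

/-! ### Lattice bookkeeping: a plaquette word reads its four bonds only -/

omit [TopologicalSpace G] [IsTopologicalGroup G] [CompactSpace G] [MeasurableSpace G] [BorelSpace G]
  [SecondCountableTopology G] in
/-- Updating a bond outside a plaquette does not change the plaquette word. [folklore] -/
theorem plaquette_update_of_notMem (U : ZdGaugeConfig 4 G) {ℓ : ZdEdge 4} (g : G) (p : ZdPlaquette 4)
    (h : ℓ ∉ plaquetteEdges p) :
    ZdGaugeConfig.plaquette (Function.update U ℓ g) p.1 p.2.1.1 p.2.1.2 =
      ZdGaugeConfig.plaquette U p.1 p.2.1.1 p.2.1.2 := by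
  have hne : ∀ e ∈ plaquetteEdges p, e ≠ ℓ := fun e he hel => h (hel ▸ he)
  simp only [plaquetteEdges, mem_insert, mem_singleton, forall_eq_or_imp, forall_eq] at hne
  obtain ⟨h1, h2, h3, h4⟩ := hne
  simp only [ZdGaugeConfig.plaquette, Function.update_of_ne h1, Function.update_of_ne h2, Function.update_of_ne h3,
    Function.update_of_ne h4]

omit [TopologicalSpace G] [IsTopologicalGroup G] [CompactSpace G] [MeasurableSpace G] [BorelSpace G]
  [SecondCountableTopology G] in
/-- A bond strictly below the base time of a plaquette is not one of its bonds. [folklore] -/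
theorem notMem_plaquetteEdges_of_time_lt {ℓ : ZdEdge 4} {p : ZdPlaquette 4} (h : ℓ.1 0 < p.1 0) :
    ℓ ∉ plaquetteEdges p := fun hl => by
  have := (level_bounds_of_mem_plaquetteEdges hl 0).1
  omega

omit [TopologicalSpace G] [IsTopologicalGroup G] [CompactSpace G] [MeasurableSpace G] [BorelSpace G]
  [SecondCountableTopology G] in
/-- The face product over the open tube one level up does not read a bond at a time `< z 0 + 1`. [folklore] -/
theorem prod_openTube_update {z : Site 4} {n : ℕ} {a : {q : Fin 4 × Fin 4 // q.1 < q.2}} {ha : (0 : Fin 4) < a.1.1}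
    (φ : G → ℝ) {ℓ : ZdEdge 4} (hℓ : ℓ.1 0 < (z + Pi.single (0 : Fin 4) (1 : ℤ) : Site 4) 0) (U : ZdGaugeConfig 4 G) (g : G) :
    ∏ p ∈ openTube (z + Pi.single 0 1) n a ha,
        φ (ZdGaugeConfig.plaquette (Function.update U ℓ g) p.1 p.2.1.1 p.2.1.2) =
      ∏ p ∈ openTube (z + Pi.single 0 1) n a ha, φ (ZdGaugeConfig.plaquette U p.1 p.2.1.1 p.2.1.2) := by
  refine prod_congr rfl fun p hp => ?_
  rw [plaquette_update_of_notMem U g p (notMem_plaquetteEdges_of_time_lt (lt_of_lt_of_le hℓ (time_le_of_mem_openTube hp)))]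

omit [CompactSpace G] [MeasurableSpace G] [BorelSpace G] [SecondCountableTopology G] in
/-- A face product of a continuous function of plaquette words is continuous. [folklore] -/
theorem continuous_prod_plaquette {φ : G → ℝ} (hφ : Continuous φ) (B : Finset (ZdPlaquette 4)) :
    Continuous fun U : ZdGaugeConfig 4 G => ∏ p ∈ B, φ (ZdGaugeConfig.plaquette U p.1 p.2.1.1 p.2.1.2) := by
  refine continuous_finsetProd _ fun p _ => hφ.comp ?_
  simp only [ZdGaugeConfig.plaquette]
  fun_prop

omit [TopologicalSpace G] [IsTopologicalGroup G] [CompactSpace G] [MeasurableSpace G] [BorelSpace G]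
  [SecondCountableTopology G] in
/-- The product over the four sides, written out. [folklore] -/
theorem prod_tubeSides (y : Site 4) (a : {q : Fin 4 × Fin 4 // q.1 < q.2}) (ha : (0 : Fin 4) < a.1.1)
    (f : ZdPlaquette 4 → ℝ) :
    ∏ p ∈ tubeSides y a ha, f p = f (y, ⟨(0, a.1.1), ha⟩) * (f (y + Pi.single a.1.2 1, ⟨(0, a.1.1), ha⟩) *
      (f (y, ⟨(0, a.1.2), ha.trans a.2⟩) * f (y + Pi.single a.1.1 1, ⟨(0, a.1.2), ha.trans a.2⟩))) := by
  have h12 := sideOrient_ne a ha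
  unfold tubeSides
  rw [prod_insert, prod_insert, prod_pair]
  · intro h
    exact S28DistanceTwo.add_single_ne y a.1.1 (congrArg Prod.fst h).symm
  · simp only [mem_insert, mem_singleton, Prod.mk.injEq, not_or]
    exact ⟨fun h => h12 h.2, fun h => h12 h.2⟩
  · simp only [mem_insert, mem_singleton, Prod.mk.injEq, not_or]
    exact ⟨fun h => S28DistanceTwo.add_single_ne y a.1.2 h.1.symm, fun h => h12 h.2, fun h => h12 h.2⟩

/-! ### The ring induction -/

/-- **Open-tube integral by ring transfer.**  For `φ = P 0` an inversion-invariant continuous class function with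
convolution powers `P k` (kernel identities in both orientations): a disc carrying `P k` of the plaquette word of the
square `(z; a)`, glued to the open tube of length `n` over it, integrates to `P (k + 4n + 1)(1)` — `n` ring transfers
(`…LongTubeRing.ring_transfer`, one per level) and one cap merge. [folklore] -/
theorem openTube_integral {φ : G → ℝ} {P : ℕ → G → ℝ} (hP0 : P 0 = φ)
    (hPc : ∀ k, Continuous (P k)) (hcl : ∀ (k : ℕ) (s t : G), P k (s * t) = P k (t * s))
    (hinv : ∀ h : G, φ h⁻¹ = φ h)
    (hkerX : ∀ (k : ℕ) (x y : G), ∫ g, P k (x * g⁻¹) * φ (g * y) ∂haarProbability G = P (k + 1) (x * y))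
    (hkerW : ∀ (k : ℕ) (x y : G), ∫ g, φ (x * g⁻¹) * P k (g * y) ∂haarProbability G = P (k + 1) (x * y))
    (a : {q : Fin 4 × Fin 4 // q.1 < q.2}) (ha : (0 : Fin 4) < a.1.1) :
    ∀ (n k : ℕ) (z : Site 4),
      ∫ U, P k (U.plaquette z a.1.1 a.1.2) *
          ∏ p ∈ openTube z n a ha, φ (U.plaquette p.1 p.2.1.1 p.2.1.2) ∂zdHaar 4 G = P (k + 4 * n + 1) 1 := by
  have hφ : Continuous φ := by rw [← hP0]; exact hPc 0
  have hφc : ∀ s t : G, φ (s * t) = φ (t * s) := by rw [← hP0]; exact hcl 0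
  -- direction facts
  have h10 : a.1.1 ≠ 0 := (ne_of_lt ha).symm
  have h20 : a.1.2 ≠ 0 := (ne_of_lt (ha.trans a.2)).symm
  have h12 : a.1.1 ≠ a.1.2 := ne_of_lt a.2
  intro n
  induction n with
  | zero =>
    intro k z
    rw [openTube_zero, show k + 4 * 0 + 1 = k + 1 by ring]
    simp only [prod_singleton, ZdGaugeConfig.plaquette]
    refine cap_merge (hPc k) hφ (hcl k) hφc (hcl (k + 1)) hinv (hkerW k) (z, a.1.1) (z + Pi.single a.1.1 1, a.1.2)
      (z + Pi.single a.1.2 1, a.1.1) (z, a.1.2) ?_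
    have s1 : z + Pi.single a.1.2 1 ≠ z := S28DistanceTwo.add_single_ne z a.1.2
    simp [h12, s1.symm]
  | succ n ih =>
    intro k z
    -- site facts for the twelve links of the bottom ring
    have s1 : z ≠ z + Pi.single a.1.1 1 := (S28DistanceTwo.add_single_ne z a.1.1).symm
    have s2 : z ≠ z + Pi.single a.1.2 1 := (S28DistanceTwo.add_single_ne z a.1.2).symm
    have s3 : z ≠ z + Pi.single 0 1 := (S28DistanceTwo.add_single_ne z 0).symm
    have s4 : z ≠ z + Pi.single a.1.1 1 + Pi.single a.1.2 1 := fun h => by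
      simpa [Pi.single_apply, h12] using congrFun h a.1.1
    have s5 : z ≠ z + Pi.single 0 1 + Pi.single a.1.1 1 := fun h => by
      simpa [Pi.single_apply, h10] using congrFun h a.1.1
    have s6 : z ≠ z + Pi.single 0 1 + Pi.single a.1.2 1 := fun h => by
      simpa [Pi.single_apply, h20] using congrFun h a.1.2
    have s7 : z + Pi.single a.1.1 1 ≠ z + Pi.single a.1.2 1 := fun h => by
      simpa [Pi.single_apply, h12] using congrFun h a.1.1
    have s8 : z + Pi.single a.1.1 1 ≠ z + Pi.single 0 1 := fun h => by
      simpa [Pi.single_apply, h10] using congrFun h a.1.1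
    have s9 : z + Pi.single a.1.1 1 ≠ z + Pi.single a.1.1 1 + Pi.single a.1.2 1 := fun h => by
      simpa [Pi.single_apply, h12.symm] using congrFun h a.1.2
    have s10 : z + Pi.single a.1.1 1 ≠ z + Pi.single 0 1 + Pi.single a.1.1 1 := fun h => by
      simpa [Pi.single_apply, h10.symm] using congrFun h 0
    have s11 : z + Pi.single a.1.1 1 ≠ z + Pi.single 0 1 + Pi.single a.1.2 1 := fun h => by
      simpa [Pi.single_apply, h12, h10] using congrFun h a.1.1
    have s12 : z + Pi.single a.1.2 1 ≠ z + Pi.single 0 1 := fun h => by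
      simpa [Pi.single_apply, h20] using congrFun h a.1.2
    have s13 : z + Pi.single a.1.2 1 ≠ z + Pi.single a.1.1 1 + Pi.single a.1.2 1 := fun h => by
      simpa [Pi.single_apply, h12] using congrFun h a.1.1
    have s14 : z + Pi.single a.1.2 1 ≠ z + Pi.single 0 1 + Pi.single a.1.1 1 := fun h => by
      simpa [Pi.single_apply, h12.symm, h20] using congrFun h a.1.2
    have s15 : z + Pi.single a.1.2 1 ≠ z + Pi.single 0 1 + Pi.single a.1.2 1 := fun h => by
      simpa [Pi.single_apply, h20.symm] using congrFun h 0
    -- unfold the bottom ring and reorder the integrand into the `ring_transfer` shape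
    set Y : ZdGaugeConfig 4 G → ℝ := fun U =>
      ∏ p ∈ openTube (z + Pi.single 0 1) n a ha, φ (U.plaquette p.1 p.2.1.1 p.2.1.2) with hY
    have hF : ∀ U : ZdGaugeConfig 4 G, P k (U.plaquette z a.1.1 a.1.2) *
        ∏ p ∈ openTube z (n + 1) a ha, φ (U.plaquette p.1 p.2.1.1 p.2.1.2) =
        P k (U (z, a.1.1) * U (z + Pi.single a.1.1 1, a.1.2) * (U (z + Pi.single a.1.2 1, a.1.1))⁻¹ * (U (z, a.1.2))⁻¹) *
          (φ (U (z, 0) * U (z + Pi.single 0 1, a.1.1) * (U (z + Pi.single a.1.1 1, 0))⁻¹ * (U (z, a.1.1))⁻¹) *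
          (φ (U (z + Pi.single a.1.1 1, 0) * U (z + Pi.single 0 1 + Pi.single a.1.1 1, a.1.2) *
              (U (z + Pi.single a.1.1 1 + Pi.single a.1.2 1, 0))⁻¹ * (U (z + Pi.single a.1.1 1, a.1.2))⁻¹) *
          (φ (U (z + Pi.single a.1.2 1, 0) * U (z + Pi.single 0 1 + Pi.single a.1.2 1, a.1.1) *
              (U (z + Pi.single a.1.1 1 + Pi.single a.1.2 1, 0))⁻¹ * (U (z + Pi.single a.1.2 1, a.1.1))⁻¹) *
          (φ (U (z, 0) * U (z + Pi.single 0 1, a.1.2) * (U (z + Pi.single a.1.2 1, 0))⁻¹ * (U (z, a.1.2))⁻¹) *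
            Y U)))) := by
      intro U
      rw [openTube_succ, prod_union (disjoint_tubeSides_openTube z n a ha), prod_tubeSides]
      simp only [hY, ZdGaugeConfig.plaquette, add_right_comm z (Pi.single a.1.2 1) (Pi.single a.1.1 1),
        add_right_comm z (Pi.single a.1.1 1) (Pi.single (0 : Fin 4) 1),
        add_right_comm z (Pi.single a.1.2 1) (Pi.single (0 : Fin 4) 1)]
      ring
    have hYc : Continuous Y := continuous_prod_plaquette hφ _
    have hYupd : ∀ (ℓ : ZdEdge 4), ℓ.1 0 = z 0 → ∀ (U : ZdGaugeConfig 4 G) (g : G), Y (Function.update U ℓ g) = Y U := by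
      intro ℓ hℓ U g
      simp only [hY]
      exact prod_openTube_update φ (by rw [hℓ]; simp) U g
    have t1 : (z + Pi.single a.1.1 1 : Site 4) 0 = z 0 := add_single_apply_zero_of_pos z ha
    have t2 : (z + Pi.single a.1.2 1 : Site 4) 0 = z 0 := add_single_apply_zero_of_pos z (ha.trans a.2)
    simp_rw [hF]
    rw [ring_transfer (ψ := P k) (φ := φ) (P₁ := P (k + 1)) (P₂ := P (k + 2)) (P₃ := P (k + 3)) (P₄ := P (k + 4))
      (hPc k) hφ (hPc (k + 1)) (hPc (k + 2)) (hPc (k + 3)) (hcl k) hφc (hcl (k + 1)) (hcl (k + 2)) (hcl (k + 3))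
      (hcl (k + 4)) hinv (hkerW k) (hkerW (k + 1)) (hkerX (k + 2)) (hkerX (k + 3))
      (z, a.1.1) (z + Pi.single a.1.1 1, a.1.2) (z + Pi.single a.1.2 1, a.1.1) (z, a.1.2)
      (z, 0) (z + Pi.single a.1.1 1, 0) (z + Pi.single a.1.2 1, 0) (z + Pi.single a.1.1 1 + Pi.single a.1.2 1, 0)
      (z + Pi.single 0 1, a.1.1) (z + Pi.single 0 1 + Pi.single a.1.1 1, a.1.2)
      (z + Pi.single 0 1 + Pi.single a.1.2 1, a.1.1) (z + Pi.single 0 1, a.1.2)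
      (by simp [h10, h12, s1, s2, s3, s4, s5, s6])
      (by simp [h20, h12.symm, s7, s8, s9, s10, s11, s1.symm])
      (by simp [h10, h12, s12, s13, s14, s15, s2.symm, s7.symm])
      (by simp [h20, h12.symm, s1, s2, s3, s4, s5, s6])
      (Y := Y) hYc (hYupd _ rfl) (hYupd _ t1) (hYupd _ t2) (hYupd _ rfl)]
    have h := ih (k + 4) (z + Pi.single 0 1)
    simp only [hY]
    simp only [ZdGaugeConfig.plaquette] at h
    rw [show k + 4 * (n + 1) + 1 = k + 4 + 4 * n + 1 by ring]
    exact h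

/-- **The tube integral as a convolution power**: for `n ≥ 1`, `∫ ∏_{f ∈ longTube z n a} φ(U_f) dg_∞ = P (4n + 1)(1) =
φ^{⋆(4n+2)}(1)` (the bottom cap is the disc `P 0 = φ`). [folklore] -/
theorem longTube_integral_eq_conv {φ : G → ℝ} {P : ℕ → G → ℝ} (hP0 : P 0 = φ)
    (hPc : ∀ k, Continuous (P k)) (hcl : ∀ (k : ℕ) (s t : G), P k (s * t) = P k (t * s))
    (hinv : ∀ h : G, φ h⁻¹ = φ h)
    (hkerX : ∀ (k : ℕ) (x y : G), ∫ g, P k (x * g⁻¹) * φ (g * y) ∂haarProbability G = P (k + 1) (x * y))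
    (hkerW : ∀ (k : ℕ) (x y : G), ∫ g, φ (x * g⁻¹) * P k (g * y) ∂haarProbability G = P (k + 1) (x * y))
    (z : Site 4) {n : ℕ} (hn : 1 ≤ n) (a : {q : Fin 4 × Fin 4 // q.1 < q.2}) (ha : (0 : Fin 4) < a.1.1) :
    ∫ U, ∏ p ∈ longTube z n a ha, φ (U.plaquette p.1 p.2.1.1 p.2.1.2) ∂zdHaar 4 G = P (4 * n + 1) 1 := by
  have h := openTube_integral hP0 hPc hcl hinv hkerX hkerW a ha n 0 z
  rw [hP0, show 0 + 4 * n + 1 = 4 * n + 1 by ring] at h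
  simp only [longTube, prod_insert (bot_notMem_openTube hn)]
  exact h

/-! ### The centred plaquette function of a representation: the three tubes, common value, positivity -/

variable {N : ℕ} (ρ : G →* Matrix (Fin N) (Fin N) ℂ)

/-- **`κ_n` as a convolution power.**  For continuous `ρ` with `Re tr ρ(h⁻¹) = Re tr ρ(h)` and the convolution powers
`P k` of `φ = Re tr ρ − m₀`: the centred face-product integral over the tube of length `n ≥ 1` over ANY spatial square is
`P (4n + 1)(1)`. [folklore] -/
theorem longTube_kappa_eq_conv (hρ : Continuous ρ) (hinvρ : ∀ h : G, ((ρ h⁻¹).trace).re = ((ρ h).trace).re)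
    {P : ℕ → G → ℝ} (hP0 : P 0 = fun g => (ρ g).trace.re - ∫ g, (ρ g).trace.re ∂haarProbability G)
    (hstep : ∀ k : ℕ, P (k + 1) = haarConv (P k) (P 0)) (z : Site 4) {n : ℕ} (hn : 1 ≤ n)
    (a : {q : Fin 4 × Fin 4 // q.1 < q.2}) (ha : (0 : Fin 4) < a.1.1) :
    (∫ U, ∏ p ∈ longTube z n a ha, ((ρ (U.plaquette p.1 p.2.1.1 p.2.1.2)).trace.re - ∫ g, (ρ g).trace.re ∂haarProbability G)
      ∂zdHaar 4 G) = P (4 * n + 1) 1 := by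
  obtain ⟨hPc, hPcl, hinv, hkerX, hkerW⟩ := conv_power_data ρ hρ hinvρ hP0 hstep
  have h := longTube_integral_eq_conv (φ := P 0) rfl hPc hPcl hinv hkerX hkerW z hn a ha
  rw [hP0] at h
  exact h

/-- **The three tube integrals coincide** (each is `φ^{⋆(4n+2)}(1)`; common value: the `(1,2)` tube). [folklore] -/
theorem longTubes_kappa (hρ : Continuous ρ) (hinvρ : ∀ h : G, ((ρ h⁻¹).trace).re = ((ρ h).trace).re) (z : Site 4)
    {n : ℕ} (hn : 1 ≤ n) :
    ∀ T ∈ longTubes z n,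
      (∫ U, ∏ p ∈ T, ((ρ (U.plaquette p.1 p.2.1.1 p.2.1.2)).trace.re - ∫ g, (ρ g).trace.re ∂haarProbability G) ∂zdHaar 4 G) =
      (∫ U, ∏ p ∈ longTube z n ⟨(1, 2), by decide⟩ (by decide),
        ((ρ (U.plaquette p.1 p.2.1.1 p.2.1.2)).trace.re - ∫ g, (ρ g).trace.re ∂haarProbability G) ∂zdHaar 4 G) := by
  obtain ⟨P, hP0, hstep⟩ : ∃ P : ℕ → G → ℝ, (P 0 = fun g => (ρ g).trace.re - ∫ g, (ρ g).trace.re ∂haarProbability G) ∧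
      ∀ k : ℕ, P (k + 1) = haarConv (P k) (P 0) :=
    ⟨fun k => Nat.rec (fun g => (ρ g).trace.re - ∫ g, (ρ g).trace.re ∂haarProbability G) (fun _ ψ =>
      haarConv ψ (fun g => (ρ g).trace.re - ∫ g, (ρ g).trace.re ∂haarProbability G)) k, rfl, fun _ => rfl⟩
  intro T hT
  rw [longTube_kappa_eq_conv ρ hρ hinvρ hP0 hstep z hn]
  rw [mem_longTubes] at hT
  rcases hT with rfl | rfl | rfl <;> exact longTube_kappa_eq_conv ρ hρ hinvρ hP0 hstep z hn _ _

/-- **`κ_n(G, r) > 0`** for the summit's data: `r : LatticeRep G` (continuous, faithful, unitary) over a compact group with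
an element `≠ 1`: the tube integral is `‖φ^{⋆(2n+1)}‖² > 0`, `φ = Re tr r.ρ − m₀ ≢ 0`. [folklore] -/
theorem longTube_kappa_pos_latticeRep [T2Space G] (r : Literature.MathematicalPhysics.QuantumFieldTheory.LatticeRep G)
    (hG : ∃ g : G, g ≠ 1) (z : Site 4) {n : ℕ} (hn : 1 ≤ n) (a : {q : Fin 4 × Fin 4 // q.1 < q.2})
    (ha : (0 : Fin 4) < a.1.1) :
    0 < (∫ U, ∏ p ∈ longTube z n a ha,
      ((r.ρ (U.plaquette p.1 p.2.1.1 p.2.1.2)).trace.re - ∫ g, (r.ρ g).trace.re ∂haarProbability G) ∂zdHaar 4 G) := by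
  obtain ⟨P, hP0, hstep⟩ : ∃ P : ℕ → G → ℝ, (P 0 = fun g => (r.ρ g).trace.re - ∫ g, (r.ρ g).trace.re ∂haarProbability G) ∧
      ∀ k : ℕ, P (k + 1) = haarConv (P k) (P 0) :=
    ⟨fun k => Nat.rec (fun g => (r.ρ g).trace.re - ∫ g, (r.ρ g).trace.re ∂haarProbability G) (fun _ ψ =>
      haarConv ψ (fun g => (r.ρ g).trace.re - ∫ g, (r.ρ g).trace.re ∂haarProbability G)) k, rfl, fun _ => rfl⟩
  have hinvρ := Summit.QuantumFields.YangMills.Theorems.S28BoxBitCompact.re_trace_map_inv_of_mem_unitaryGroup r.ρ r.mem_unitary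
  obtain ⟨hPc, hPcl, hinv, hkerX, hkerW⟩ := conv_power_data r.ρ r.continuous hinvρ hP0 hstep
  rw [longTube_kappa_eq_conv r.ρ r.continuous hinvρ hP0 hstep z hn a ha, show 4 * n + 1 = 2 * n + 2 * n + 1 by ring]
  refine conv_power_odd_at_one_pos (hPc 0) (hPcl 0) hinv rfl hstep ?_ (2 * n)
  obtain ⟨g, hg⟩ := Summit.QuantumFields.YangMills.Theorems.S28BoxBitCompact.exists_re_trace_ne r.ρ r.mem_unitary r.injective hG
  by_contra h
  simp only [not_exists, not_not, hP0, sub_eq_zero] at h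
  exact hg ((h g).trans (h 1).symm)

end Summit.QuantumFields.YangMills.Cruxes.NT.StrongCouplingRung.LongTube

end
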